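import Mathlib
import Literature.Analysis.FluidPDE.Tao2016AveragedNS.BoundedEternalSolutions
import Summits.NavierStokesRegularity.NavierStokesRegularity.Theorems.TaoLadderRungTwoBreakNoSurvivingEternalViscBddOneUpwardFluxThroughput
import HarnessLib

/-!
# The DISCOUNTED THROUGHPUT BALANCE of a bounded admissible inviscid eternal solution — an exact, sign-free inter-bond law
# (helper toward (ρ0) `stub_noSurvivingEternalBddOne` of `TaoLadderRungTwoBreak.NoSurvivingEternalViscBddOne`, stmt-NavierStokesRegularity-20419)

MODEL lattice ODEs only (Tao 2016 §4, §6.4; cell vocabulary `IsEternal`, `UniformBound`, `physEnergy`, `physFlux`); nothing here is a statement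
about the Navier–Stokes equations; no stub, crux or summit is closed (`--supports stmt-NavierStokesRegularity-20419`).  Companion of the
upward-flux rungs (`…UpwardFluxThroughput/Visc/Rung/Backscatter/Orthant`), which are INEQUALITIES needing a sign or a backscatter budget.
Here is the EXACT law behind them, valid for every uniformly bounded admissible inviscid eternal solution of a cancelling table and every
discount rate `0 < δ < 1`, with NO sign assumption:

  `∫_ℝ e^{−2δσ} F_k dσ = ∫_ℝ e^{−2δσ} F_{k+1} dσ + 2δ ∫_ℝ e^{−2δσ} E_{k+1} dσ`   (`discountedThroughput_balance`)

— the `δ`-discounted traffic of the bond `k → k+1` exceeds that of the bond `k+1 → k+2` by exactly `2δ ×` the discounted energy-time of the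
shell between them (`discountedThroughput_antitone`: discounted traffic is non-increasing up the ladder).  It is the Laplace transform in
log-time of the shell identity `E_{k+1}' = F_k − F_{k+1}`; as `δ → 0⁺` the tax `2δ∫e^{−2δσ}E_{k+1}` tends (Abel) to the permanent wake
`E_{k+1}(+∞)` and the law degenerates to the wake bookkeeping `Φ_k = Φ_{k+1} + w_{k+1}` used by the rungs; for `δ > 0` all three integrals
converge absolutely from the uniform bound in the past (`E_j ≤ Λ^{-2j}B²e^{2σ}`) and the admissibility clause `bdd` in the future
(`integrable_discountedFlux`, `integrable_discountedEnergy`).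
READING for the census of ⟨20419⟩: a sign-free replacement for the backscatter budget must bound the LATE (large-`σ`) negative part of `F_k`,
since discounting already controls everything else exactly.  HONEST LABEL: an identity; (ρ0), (ρ+), ⟨20419⟩ and every NS statement remain OPEN.
-/

noncomputable section

-- the summit and its single sub-problem share the name (CONVENTIONS §1)
set_option linter.dupNamespace false

namespace Summit.NavierStokesRegularity.NavierStokesRegularity.Theorems.NoSurvivingEternalViscBddOne.UpwardFlux

open Set Filter Topology MeasureTheory
open scoped RealInnerProductSpace
open Literature.Analysis.FluidPDE Literature.Analysis.FluidPDE.TaoCascade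
open Summit.NavierStokesRegularity.NavierStokesRegularity.Theorems.NoSurvivingEternalViscBddOne.SmallAction
  (continuous_physEnergy continuous_physFlux tendsto_physEnergy_atBot exists_physEnergy_le physEnergy_le_exp)

variable {m : ℕ} {ε₀ νh : ℝ} {α : Fin m → Fin m → Fin m → ℤ × ℤ × ℤ → ℝ} {W : ℤ → ℝ → Em m}

/-! ## Absolute convergence of the discounted integrals -/

/-- A continuous function bounded by `C₁e^{aσ}` on `σ ≤ 0` (`a > 0`) and by an integrable function on `σ > 0` is integrable on `ℝ`. [folklore] -/
theorem integrable_of_pastExp_futureDom {f g : ℝ → ℝ} (hf : Continuous f) {a C₁ : ℝ} (ha : 0 < a)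
    (hpast : ∀ σ, σ ≤ 0 → |f σ| ≤ C₁ * Real.exp (a * σ)) (hg : Integrable g) (hfut : ∀ σ, 0 < σ → |f σ| ≤ g σ) :
    Integrable f := by
  have h1 : IntegrableOn f (Iic 0) := by
    refine Integrable.mono' ((integrableOn_exp_mul_Iic ha 0).const_mul C₁) hf.aestronglyMeasurable.restrict ?_
    exact (ae_restrict_iff' measurableSet_Iic).2 (Eventually.of_forall fun σ hσ => by
      rw [Real.norm_eq_abs]; exact hpast σ hσ)
  have h2 : IntegrableOn f (Ioi 0) := by
    refine Integrable.mono' hg.integrableOn hf.aestronglyMeasurable.restrict ?_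
    exact (ae_restrict_iff' measurableSet_Ioi).2 (Eventually.of_forall fun σ hσ => by
      rw [Real.norm_eq_abs]; exact hfut σ hσ)
  have h := h1.union h2
  rwa [Iic_union_Ioi, integrableOn_univ] at h

/-- **The discounted bond flux `e^{−2δσ}F_k` is integrable on `ℝ`** (`0 < δ < 1`, uniformly bounded admissible eternal solution, any `ν̂ ≥ 0`):
in the past `|F_k| ≤ 2C_AΛ⁻¹B·Λ^{-2k}B²e^{2σ}`, in the future `e^{−2δσ} ≤ 1` and `F_k` is integrable.
[cite: Tao2016AveragedNS, §4 Lemma 4.1 (4.9)–(4.10), §6.4; tree `abs_physFlux_le`] -/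
theorem integrable_discountedFlux (hε : 0 < ε₀) (hW : IsEternalVisc ε₀ νh α W) (hc : IsCancellingCoeff α)
    (hU : UniformBound W) {δ : ℝ} (hδ0 : 0 < δ) (hδ1 : δ < 1) (k : ℤ) :
    Integrable (fun σ => Real.exp (-(2 * δ * σ)) * physFlux ε₀ α W k σ) := by
  obtain ⟨B, hB⟩ := hU
  have hB0 : 0 ≤ B := (norm_nonneg _).trans (hB 0 0)
  have hκ₀nn : 0 ≤ 2 * fluxConst α * (bigLam ε₀)⁻¹ := by
    have := fluxConst_nonneg α; have := (bigLam_pos (by linarith : (-1 : ℝ) < ε₀)).le; positivity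
  have hFk := integrable_physFlux hε hW hc ⟨B, hB⟩ k
  have cF := continuous_physFlux hW hc k
  have cf : Continuous (fun σ => Real.exp (-(2 * δ * σ)) * physFlux ε₀ α W k σ) := by fun_prop
  set C₁ := 2 * fluxConst α * (bigLam ε₀)⁻¹ * B * ((bigLam ε₀ ^ k)⁻¹ ^ 2 * B ^ 2) with hC₁
  refine integrable_of_pastExp_futureDom cf (a := 2 * (1 - δ)) (C₁ := C₁) (by linarith) ?_ hFk.abs ?_
  · intro σ hσ
    have h1 := abs_physFlux_le hε hc W k σ
    have h2 := physEnergy_le_exp hε hB k σ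
    have h3 : |physFlux ε₀ α W k σ| ≤ C₁ * Real.exp (2 * σ) := by
      calc |physFlux ε₀ α W k σ| ≤ 2 * fluxConst α * (bigLam ε₀)⁻¹ * ‖W (k + 1) σ‖ * physEnergy ε₀ W k σ := h1
        _ ≤ 2 * fluxConst α * (bigLam ε₀)⁻¹ * B * ((bigLam ε₀ ^ k)⁻¹ ^ 2 * B ^ 2 * Real.exp (2 * σ)) :=
            mul_le_mul (mul_le_mul_of_nonneg_left (hB _ _) hκ₀nn) h2 (physEnergy_nonneg _ _ _ _) (by positivity)
        _ = C₁ * Real.exp (2 * σ) := by rw [hC₁]; ring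
    rw [abs_mul, abs_of_pos (Real.exp_pos _)]
    calc Real.exp (-(2 * δ * σ)) * |physFlux ε₀ α W k σ| ≤ Real.exp (-(2 * δ * σ)) * (C₁ * Real.exp (2 * σ)) :=
          mul_le_mul_of_nonneg_left h3 (Real.exp_pos _).le
      _ = C₁ * Real.exp (2 * (1 - δ) * σ) := by
          rw [show 2 * (1 - δ) * σ = -(2 * δ * σ) + 2 * σ by ring, Real.exp_add]; ring
  · intro σ hσ
    rw [abs_mul, abs_of_pos (Real.exp_pos _)]
    have h1 : Real.exp (-(2 * δ * σ)) ≤ 1 := Real.exp_le_one_iff.2 (by nlinarith)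
    have := mul_le_mul_of_nonneg_right h1 (abs_nonneg (physFlux ε₀ α W k σ))
    rwa [one_mul] at this

/-- **The discounted shell energy `e^{−2δσ}E_k` is integrable on `ℝ`** (`0 < δ < 1`): `E_k ≤ Λ^{-2k}B²e^{2σ}` in the past, `E_k ≤ S` in the future.
[cite: Tao2016AveragedNS, §4 Lemma 4.1 (4.10), §6.4; cell vocabulary] -/
theorem integrable_discountedEnergy (hε : 0 < ε₀) (hW : IsEternalVisc ε₀ νh α W) (hU : UniformBound W)
    {δ : ℝ} (hδ0 : 0 < δ) (hδ1 : δ < 1) (k : ℤ) :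
    Integrable (fun σ => Real.exp (-(2 * δ * σ)) * physEnergy ε₀ W k σ) := by
  obtain ⟨S, hS⟩ := exists_physEnergy_le hε hW hU k
  obtain ⟨B, hB⟩ := hU
  have cE := continuous_physEnergy hW k
  have cf : Continuous (fun σ => Real.exp (-(2 * δ * σ)) * physEnergy ε₀ W k σ) := by fun_prop
  have hS0 : 0 ≤ S := (physEnergy_nonneg ε₀ W k 0).trans (hS 0)
  -- future dominator `S e^{-2δσ}` on `σ > 0`, extended by `S` on `σ ≤ 0`
  set g : ℝ → ℝ := fun σ => S * Real.exp (-(2 * δ) * σ) with hg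
  have hgint : IntegrableOn g (Ioi 0) := (integrableOn_exp_mul_Ioi (by linarith : -(2 * δ) < 0) 0).const_mul S
  set g' : ℝ → ℝ := (Ioi (0 : ℝ)).indicator g with hg'
  have hg'int : Integrable g' := (integrable_indicator_iff measurableSet_Ioi).2 hgint
  refine integrable_of_pastExp_futureDom cf (a := 2 * (1 - δ)) (C₁ := (bigLam ε₀ ^ k)⁻¹ ^ 2 * B ^ 2) (by linarith)
    ?_ hg'int ?_
  · intro σ hσ
    rw [abs_mul, abs_of_pos (Real.exp_pos _), abs_of_nonneg (physEnergy_nonneg _ _ _ _)]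
    calc Real.exp (-(2 * δ * σ)) * physEnergy ε₀ W k σ
        ≤ Real.exp (-(2 * δ * σ)) * ((bigLam ε₀ ^ k)⁻¹ ^ 2 * B ^ 2 * Real.exp (2 * σ)) :=
          mul_le_mul_of_nonneg_left (physEnergy_le_exp hε hB k σ) (Real.exp_pos _).le
      _ = (bigLam ε₀ ^ k)⁻¹ ^ 2 * B ^ 2 * Real.exp (2 * (1 - δ) * σ) := by
          rw [show 2 * (1 - δ) * σ = -(2 * δ * σ) + 2 * σ by ring, Real.exp_add]; ring
  · intro σ hσ
    have hmem : σ ∈ Ioi (0 : ℝ) := hσ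
    rw [hg', indicator_of_mem hmem]
    show |Real.exp (-(2 * δ * σ)) * physEnergy ε₀ W k σ| ≤ S * Real.exp (-(2 * δ) * σ)
    rw [abs_mul, abs_of_pos (Real.exp_pos _), abs_of_nonneg (physEnergy_nonneg _ _ _ _),
      show -(2 * δ) * σ = -(2 * δ * σ) by ring, mul_comm S]
    exact mul_le_mul_of_nonneg_left (hS σ) (Real.exp_pos _).le

/-! ## The balance law -/

/-- **THE DISCOUNTED THROUGHPUT BALANCE** (inviscid, `0 < δ < 1`, NO sign assumption): for a uniformly bounded admissible inviscid eternal solution of a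
cancelling table, `∫_ℝ e^{−2δσ}F_k = ∫_ℝ e^{−2δσ}F_{k+1} + 2δ∫_ℝ e^{−2δσ}E_{k+1}` — the Laplace transform in log-time of `E_{k+1}' = F_k − F_{k+1}`
(boundary terms vanish: `e^{−2δσ}E_{k+1} → 0` at both ends).
[cite: Tao2016AveragedNS, §4 Lemma 4.1 (4.8)–(4.10) with (4.3), §6.4; tree `hasDerivAt_physEnergy`] -/
theorem discountedThroughput_balance (hε : 0 < ε₀) (hW : IsEternal ε₀ α W) (hc : IsCancellingCoeff α) (hU : UniformBound W)
    {δ : ℝ} (hδ0 : 0 < δ) (hδ1 : δ < 1) (k : ℤ) :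
    (∫ σ, Real.exp (-(2 * δ * σ)) * physFlux ε₀ α W k σ)
      = (∫ σ, Real.exp (-(2 * δ * σ)) * physFlux ε₀ α W (k + 1) σ)
        + 2 * δ * ∫ σ, Real.exp (-(2 * δ * σ)) * physEnergy ε₀ W (k + 1) σ := by
  have hW' : IsEternalVisc ε₀ 0 α W := hW.isEternalVisc
  have hIFk := integrable_discountedFlux hε hW' hc hU hδ0 hδ1 k
  have hIFk1 := integrable_discountedFlux hε hW' hc hU hδ0 hδ1 (k + 1)
  have hIE := integrable_discountedEnergy hε hW' hU hδ0 hδ1 (k + 1)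
  have cFk := continuous_physFlux hW' hc k
  have cFk1 := continuous_physFlux hW' hc (k + 1)
  have cE := continuous_physEnergy hW' (k + 1)
  -- the derivative of `σ ↦ e^{-2δσ} E_{k+1}(σ)`
  have hderiv : ∀ σ, HasDerivAt (fun x => Real.exp (-(2 * δ * x)) * physEnergy ε₀ W (k + 1) x)
      (-(2 * δ) * (Real.exp (-(2 * δ * σ)) * physEnergy ε₀ W (k + 1) σ)
        + (Real.exp (-(2 * δ * σ)) * physFlux ε₀ α W k σ
          - Real.exp (-(2 * δ * σ)) * physFlux ε₀ α W (k + 1) σ)) σ := by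
    intro σ
    have hE := hasDerivAt_physEnergy hε hW' hc (k + 1) σ
    have hv : viscCoef ε₀ 0 (k + 1) σ = 0 := by unfold viscCoef; ring
    rw [hv, add_sub_cancel_right] at hE
    have hexp : HasDerivAt (fun x => Real.exp (-(2 * δ * x))) (Real.exp (-(2 * δ * σ)) * (-(2 * δ))) σ := by
      have h := ((hasDerivAt_id σ).const_mul (2 * δ)).neg.exp
      simp only [id, mul_one] at h
      exact h
    refine (hexp.mul hE).congr_deriv ?_
    ring
  have cD : Continuous (fun σ => -(2 * δ) * (Real.exp (-(2 * δ * σ)) * physEnergy ε₀ W (k + 1) σ)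
        + (Real.exp (-(2 * δ * σ)) * physFlux ε₀ α W k σ
          - Real.exp (-(2 * δ * σ)) * physFlux ε₀ α W (k + 1) σ)) := by fun_prop
  have hID : Integrable (fun σ => -(2 * δ) * (Real.exp (-(2 * δ * σ)) * physEnergy ε₀ W (k + 1) σ)
        + (Real.exp (-(2 * δ * σ)) * physFlux ε₀ α W k σ
          - Real.exp (-(2 * δ * σ)) * physFlux ε₀ α W (k + 1) σ)) :=
    (hIE.const_mul (-(2 * δ))).add (hIFk.sub hIFk1)
  -- FTC on `[a, b]`
  have hftc : ∀ a b : ℝ, (∫ σ in a..b, (-(2 * δ) * (Real.exp (-(2 * δ * σ)) * physEnergy ε₀ W (k + 1) σ)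
        + (Real.exp (-(2 * δ * σ)) * physFlux ε₀ α W k σ
          - Real.exp (-(2 * δ * σ)) * physFlux ε₀ α W (k + 1) σ)))
      = Real.exp (-(2 * δ * b)) * physEnergy ε₀ W (k + 1) b - Real.exp (-(2 * δ * a)) * physEnergy ε₀ W (k + 1) a :=
    fun a b => intervalIntegral.integral_eq_sub_of_hasDerivAt (fun σ _ => hderiv σ) (cD.intervalIntegrable _ _)
  -- the boundary terms vanish at `±∞`
  obtain ⟨S, hS⟩ := exists_physEnergy_le hε hW' hU (k + 1)
  have hHnn : ∀ σ, 0 ≤ Real.exp (-(2 * δ * σ)) * physEnergy ε₀ W (k + 1) σ := fun σ =>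
    mul_nonneg (Real.exp_pos _).le (physEnergy_nonneg _ _ _ _)
  have hTop : Tendsto (fun σ => Real.exp (-(2 * δ * σ)) * physEnergy ε₀ W (k + 1) σ) atTop (𝓝 0) := by
    have h0 : Tendsto (fun σ : ℝ => 2 * δ * σ) atTop atTop := tendsto_id.const_mul_atTop (by linarith)
    have hexp : Tendsto (fun σ : ℝ => Real.exp (-(2 * δ * σ))) atTop (𝓝 0) :=
      Real.tendsto_exp_atBot.comp (tendsto_neg_atTop_atBot.comp h0)
    have hup : Tendsto (fun σ => Real.exp (-(2 * δ * σ)) * S) atTop (𝓝 0) := by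
      have := hexp.mul_const S; rwa [zero_mul] at this
    exact tendsto_of_tendsto_of_tendsto_of_le_of_le tendsto_const_nhds hup hHnn
      (fun σ => mul_le_mul_of_nonneg_left (hS σ) (Real.exp_pos _).le)
  have hBot : Tendsto (fun σ => Real.exp (-(2 * δ * σ)) * physEnergy ε₀ W (k + 1) σ) atBot (𝓝 0) := by
    obtain ⟨B, hB⟩ := hU
    have hle : ∀ σ : ℝ, Real.exp (-(2 * δ * σ)) * physEnergy ε₀ W (k + 1) σ
        ≤ (bigLam ε₀ ^ (k + 1))⁻¹ ^ 2 * B ^ 2 * Real.exp (2 * (1 - δ) * σ) := by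
      intro σ
      calc Real.exp (-(2 * δ * σ)) * physEnergy ε₀ W (k + 1) σ
          ≤ Real.exp (-(2 * δ * σ)) * ((bigLam ε₀ ^ (k + 1))⁻¹ ^ 2 * B ^ 2 * Real.exp (2 * σ)) :=
            mul_le_mul_of_nonneg_left (physEnergy_le_exp hε hB (k + 1) σ) (Real.exp_pos _).le
        _ = (bigLam ε₀ ^ (k + 1))⁻¹ ^ 2 * B ^ 2 * Real.exp (2 * (1 - δ) * σ) := by
            rw [show 2 * (1 - δ) * σ = -(2 * δ * σ) + 2 * σ by ring, Real.exp_add]; ring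
    have hexp : Tendsto (fun σ : ℝ => Real.exp (2 * (1 - δ) * σ)) atBot (𝓝 0) :=
      Real.tendsto_exp_atBot.comp (tendsto_id.const_mul_atBot (by linarith : (0 : ℝ) < 2 * (1 - δ)))
    have hup : Tendsto (fun σ => (bigLam ε₀ ^ (k + 1))⁻¹ ^ 2 * B ^ 2 * Real.exp (2 * (1 - δ) * σ)) atBot (𝓝 0) := by
      have := hexp.const_mul ((bigLam ε₀ ^ (k + 1))⁻¹ ^ 2 * B ^ 2); rwa [mul_zero] at this
    exact tendsto_of_tendsto_of_tendsto_of_le_of_le tendsto_const_nhds hup hHnn hle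
  -- the whole-line integral of the derivative vanishes
  have hlim : Tendsto (fun i : ℕ => ∫ σ in (-(i : ℝ))..(i : ℝ),
        (-(2 * δ) * (Real.exp (-(2 * δ * σ)) * physEnergy ε₀ W (k + 1) σ)
          + (Real.exp (-(2 * δ * σ)) * physFlux ε₀ α W k σ
            - Real.exp (-(2 * δ * σ)) * physFlux ε₀ α W (k + 1) σ))) atTop
      (𝓝 (∫ σ, (-(2 * δ) * (Real.exp (-(2 * δ * σ)) * physEnergy ε₀ W (k + 1) σ)
          + (Real.exp (-(2 * δ * σ)) * physFlux ε₀ α W k σ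
            - Real.exp (-(2 * δ * σ)) * physFlux ε₀ α W (k + 1) σ)))) :=
    intervalIntegral_tendsto_integral hID (tendsto_neg_atTop_atBot.comp tendsto_natCast_atTop_atTop)
      tendsto_natCast_atTop_atTop
  have hlim' : Tendsto (fun i : ℕ => ∫ σ in (-(i : ℝ))..(i : ℝ),
        (-(2 * δ) * (Real.exp (-(2 * δ * σ)) * physEnergy ε₀ W (k + 1) σ)
          + (Real.exp (-(2 * δ * σ)) * physFlux ε₀ α W k σ
            - Real.exp (-(2 * δ * σ)) * physFlux ε₀ α W (k + 1) σ))) atTop (𝓝 (0 - 0)) := by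
    have h1 := hTop.comp tendsto_natCast_atTop_atTop
    have h2 := hBot.comp (tendsto_neg_atTop_atBot.comp tendsto_natCast_atTop_atTop)
    refine (h1.sub h2).congr fun i => ?_
    simp only [Function.comp]
    exact (hftc _ _).symm
  have hzero := tendsto_nhds_unique hlim hlim'
  have hsub : Integrable (fun σ => Real.exp (-(2 * δ * σ)) * physFlux ε₀ α W k σ
      - Real.exp (-(2 * δ * σ)) * physFlux ε₀ α W (k + 1) σ) := hIFk.sub hIFk1
  rw [sub_zero, integral_add (hIE.const_mul (-(2 * δ))) hsub, integral_const_mul,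
    integral_sub hIFk hIFk1] at hzero
  linarith

/-- **Discounted traffic is non-increasing up the ladder**: `∫e^{−2δσ}F_{k+1} ≤ ∫e^{−2δσ}F_k` for every `0 < δ < 1` (inviscid, no sign assumption).
[cite: Tao2016AveragedNS, §4 Lemma 4.1 (4.8)–(4.10), §6.4; this file] -/
theorem discountedThroughput_antitone (hε : 0 < ε₀) (hW : IsEternal ε₀ α W) (hc : IsCancellingCoeff α) (hU : UniformBound W)
    {δ : ℝ} (hδ0 : 0 < δ) (hδ1 : δ < 1) (k : ℤ) :
    (∫ σ, Real.exp (-(2 * δ * σ)) * physFlux ε₀ α W (k + 1) σ)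
      ≤ ∫ σ, Real.exp (-(2 * δ * σ)) * physFlux ε₀ α W k σ := by
  have h := discountedThroughput_balance hε hW hc hU hδ0 hδ1 k
  have h0 : 0 ≤ ∫ σ, Real.exp (-(2 * δ * σ)) * physEnergy ε₀ W (k + 1) σ :=
    integral_nonneg fun σ => mul_nonneg (Real.exp_pos _).le (physEnergy_nonneg _ _ _ _)
  nlinarith

/-- **Telescoped form**: `∫e^{−2δσ}F_k = ∫e^{−2δσ}F_{k+n} + 2δ Σ_{j=1}^{n} ∫e^{−2δσ}E_{k+j}` — the discounted traffic of a bond pays the discounted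
energy-time of EVERY shell above it.
[cite: Tao2016AveragedNS, §4 Lemma 4.1 (4.8)–(4.10), §6.4; this file] -/
theorem discountedThroughput_telescope (hε : 0 < ε₀) (hW : IsEternal ε₀ α W) (hc : IsCancellingCoeff α) (hU : UniformBound W)
    {δ : ℝ} (hδ0 : 0 < δ) (hδ1 : δ < 1) (k : ℤ) (n : ℕ) :
    (∫ σ, Real.exp (-(2 * δ * σ)) * physFlux ε₀ α W k σ)
      = (∫ σ, Real.exp (-(2 * δ * σ)) * physFlux ε₀ α W (k + n) σ)
        + 2 * δ * ∑ j ∈ Finset.range n, ∫ σ, Real.exp (-(2 * δ * σ)) * physEnergy ε₀ W (k + j + 1) σ := by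
  induction n with
  | zero => simp
  | succ n ih =>
    have h := discountedThroughput_balance hε hW hc hU hδ0 hδ1 (k + n)
    rw [Finset.sum_range_succ, show k + ((n + 1 : ℕ) : ℤ) = k + n + 1 by push_cast; ring]
    rw [ih, h]; ring

end Summit.NavierStokesRegularity.NavierStokesRegularity.Theorems.NoSurvivingEternalViscBddOne.UpwardFlux

end
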